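import Summits.QuantumFields.YangMills.Theorems.BalabanUVNodesN07QuadPartReality
import Summits.QuantumFields.YangMills.Theorems.BalabanUVNodesN07SchemeTokensOfRecord
import HarnessLib

/-!
# NODE N07 — 3g′'s TOKEN BUNDLE `SchemeTokOfRecord = RegimeTok ∧ ChartSUTok ∧ HessSymmTok Δ2 ∧ C1Tok` AT A GUARDED BACKGROUND, FOR THE (3.134) DATUM:
# TWO OF FOUR CONJUNCTS ARE TREE THEOREMS (`HessSymmTok` ✓`…N07QuadPartReality`, `C1Tok` ✓p820144), SO THE BUNDLE ⟺ `RegimeTok ∧ ChartSUTok`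

Cell `pub-ymgap`, width seat `pub-ymgap-dag-n07-w3` (g26), CLAIM-7.  `--kind proof --supports stmt-QuantumFields-27238 --as helper`; count-neutral.
[15] = [Balaban1985Variational]; [B9] = [Balaban1985BackgroundPropagators].

WHAT.  def-Y's 3g′ `Node00.BgSchemeOfRecord.SchemeTokOfRecord` is the text a statement row over the scheme of record concludes; its row binders are the guard on `U₀`,
the displayed proofs, and `Delta2Tok ∧ Delta2SymmTok` pinning print's `Δ⁽²⁾`.  Under exactly those binders this file records, by name, that the bundle reduces to its
two Bałaban-sized conjuncts: Prop. 6's regime (117)–(121) (`RegimeTok` ⇐ (R1) [B9] Thm 3.13 + (R2) Prop. 4, the wall and the hand) and the reality of the fixed point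
(`ChartSUTok`).
* `schemeTokOfRecord_iff` — `SchemeTokOfRecord … ↔ RegimeTok ∧ ChartSUTok` (guard; `Delta2Tok`, `Delta2SymmTok` for `Δ2`).
* `schemeTokOfRecord_of_regimeTok_of_chartSUTok` — the assembly direction.
* `hessSymmTok_and_c1Tok` — the two discharged conjuncts together.

HONEST LABELS.  By-name bookkeeping; `RegimeTok` and `ChartSUTok` are NOT touched (OPEN); no estimate.  Count-neutral; N07 NOT discharged; P0 ⟨26900⟩ OPEN; R4 is the
conditional finite-𝕋⁴ rung only.  Nothing here is a claim about the Yang–Mills mass gap (`Summit.QuantumFields`): finite torus, fixed `ε`; nothing continuum ∕ OS ∕ Clay.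
-/

set_option autoImplicit false

noncomputable section

open scoped Matrix Matrix.Norms.L2Operator InnerProductSpace ComplexConjugate

namespace Summit.QuantumFields.YangMills.Theorems.N07SchemeTokBundleOfRecord

open Literature.MathematicalPhysics.QuantumFieldTheory.Balaban1983to89
open Literature.MathematicalPhysics.QuantumFieldTheory.Balaban1983to89.T4Continuum (T4Family)
open T4Continuum BlockAveraging
open B11Eq103H1Complex (SiteL2K BondL2K)
open Node00
open Summit.QuantumFields.YangMills.Theorems.N07SchemeTokensOfRecord (c1Tok_of_smallBelow)
open Summit.QuantumFields.YangMills.Theorems.N07QuadPartReality (hessSymmTok_of_delta2Tok_of_delta2SymmTok)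

variable (F : T4Family) (N : ℕ) [NeZero N] (K : ℕ) (k : ℕ) (Ω : ℕ → Set (Site (F.P K) 0)) (U₀ : GaugeField (F.P K) 0 (SU N))
  [Fact (0 < (F.L : ℝ))] [Fact (0 < (F.P K).eta k)] [Fact (0 < c0Rec F K k)] [Fact (∀ c, 0 < wBRec F K k c)]
  (dom : Set (GaugeField (F.P K) k (SU N))) (levB : PBond (F.P K) k → ℕ)
  (Gp : SiteL2K ℂ (F.P K).d (fun _ => (F.P K).sitesPerDir 0) (c0Rec F K k) (WRec N) →ₗ[ℂ]
    SiteL2K ℂ (F.P K).d (fun _ => (F.P K).sitesPerDir 0) (c0Rec F K k) (WRec N))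
  {Δ2 : BondL2K ℂ (F.P K).d (fun _ => (F.P K).sitesPerDir 0) (c0Rec F K k) (WRec N) →ₗ[ℂ]
    BondL2K ℂ (F.P K).d (fun _ => (F.P K).sitesPerDir 0) (c0Rec F K k) (WRec N)} (a : ℝ)
  (hposπ : ∀ x, x ≠ 0 → 0 < RCLike.re ⟪x, laplaceAOfRecordAt F N k U₀ (hessOpOfRecord128 F N k U₀ Gp (QflatOfRecord F N k) Δ2)
    (QOfRecord F N k U₀) (QflatOfRecord F N k) a x⟫_ℂ)
  (hposb : ∀ x, x ≠ 0 → 0 < RCLike.re ⟪x, laplaceAOfRecord F N k U₀ (QOfRecord F N k U₀) (QflatOfRecord F N k) a x⟫_ℂ)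
  (hQ : Function.Surjective (QOfRecord F N k U₀)) (εC B₀ C₄ a₃ j a𝔄 ε₄ : ℝ)

/-- **THE TWO DISCHARGED CONJUNCTS TOGETHER**: at a guarded background, for the (3.134) datum, `HessSymmTok Δ2 ∧ C1Tok` (✓`hessSymmTok_of_delta2Tok_of_delta2SymmTok`, ✓`c1Tok_of_smallBelow`).
[cite: Balaban1985BackgroundPropagators, (3.134) p.422, (3.124) p.420; Balaban1985Variational, (44) p.285, (56) p.286] -/
theorem hessSymmTok_and_c1Tok (h : SmallBelow (avOfRecord F N K) k U₀) (hΔ : Delta2Tok F N K k Ω U₀ levB a hposb hQ Δ2) (hs : Delta2SymmTok F N K k Ω U₀ Δ2) :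
    HessSymmTok F N K k U₀ Δ2 ∧ C1Tok F N K k Ω U₀ levB :=
  ⟨hessSymmTok_of_delta2Tok_of_delta2SymmTok F N K k Ω U₀ levB a hposb hQ h hΔ hs, c1Tok_of_smallBelow F N K k Ω U₀ levB h⟩

/-- ★★ **THE BUNDLE REDUCES TO ITS TWO BAŁABAN-SIZED CONJUNCTS**: under the row binders (guard, displayed proofs, `Delta2Tok ∧ Delta2SymmTok` for `Δ2`),
`SchemeTokOfRecord … ↔ RegimeTok ∧ ChartSUTok`. [cite: Balaban1985Variational, Prop. 6 (115)–(121) p.295; Balaban1985BackgroundPropagators, (3.134) p.422] -/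
theorem schemeTokOfRecord_iff (h : SmallBelow (avOfRecord F N K) k U₀) (hΔ : Delta2Tok F N K k Ω U₀ levB a hposb hQ Δ2) (hs : Delta2SymmTok F N K k Ω U₀ Δ2) :
    SchemeTokOfRecord F N K k Ω U₀ dom levB Gp Δ2 a hposπ hposb hQ εC B₀ C₄ a₃ j a𝔄 ε₄ ↔
      (bgSchemeOfRecord F N K k Ω U₀ dom levB Gp Δ2 a hposπ hposb hQ εC B₀ C₄ a₃ j a𝔄 ε₄).RegimeTok ∧
        (bgSchemeOfRecord F N K k Ω U₀ dom levB Gp Δ2 a hposπ hposb hQ εC B₀ C₄ a₃ j a𝔄 ε₄).ChartSUTok := by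
  have h2 := hessSymmTok_and_c1Tok F N K k Ω U₀ levB a hposb hQ h hΔ hs
  unfold SchemeTokOfRecord
  exact ⟨fun hT => ⟨hT.1, hT.2.1⟩, fun hT => ⟨hT.1, hT.2, h2.1, h2.2⟩⟩

/-- ★★ **ASSEMBLY**: `RegimeTok → ChartSUTok → SchemeTokOfRecord` under the row binders. [cite: Balaban1985Variational, Prop. 6 (115)–(121) p.295] -/
theorem schemeTokOfRecord_of_regimeTok_of_chartSUTok (h : SmallBelow (avOfRecord F N K) k U₀) (hΔ : Delta2Tok F N K k Ω U₀ levB a hposb hQ Δ2)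
    (hs : Delta2SymmTok F N K k Ω U₀ Δ2)
    (hR : (bgSchemeOfRecord F N K k Ω U₀ dom levB Gp Δ2 a hposπ hposb hQ εC B₀ C₄ a₃ j a𝔄 ε₄).RegimeTok)
    (hC : (bgSchemeOfRecord F N K k Ω U₀ dom levB Gp Δ2 a hposπ hposb hQ εC B₀ C₄ a₃ j a𝔄 ε₄).ChartSUTok) :
    SchemeTokOfRecord F N K k Ω U₀ dom levB Gp Δ2 a hposπ hposb hQ εC B₀ C₄ a₃ j a𝔄 ε₄ :=
  (schemeTokOfRecord_iff F N K k Ω U₀ dom levB Gp a hposπ hposb hQ εC B₀ C₄ a₃ j a𝔄 ε₄ h hΔ hs).2 ⟨hR, hC⟩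

end Summit.QuantumFields.YangMills.Theorems.N07SchemeTokBundleOfRecord

end
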